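import Summits.QuantumAdvantage.AdviceFreeQNC0.WalkCharacterCoefficients
import HarnessLib

/-!
# Cell qa-qnc0 (rung F-Q1, route RingFrame, crux α `RingToElim`): the RING PHASE LAW — on
# `2D+2` bits no walk strategy of degree `D` is perfect unless its charge is `c ≡ −(D+1) (mod 3)`
# (planner qa-qnc0-p1 TARGET §15.3, all `D`, every charge)

The FULL EXACT LAW (`fullSpan_not_perfect`, `WalkExactLaw.lean`) forbids perfect play of degree
`D` on `2D+3` bits for every strategy with free `𝔽₄[u]_{≤D}` coefficients.  One bit lower, on
`2D+2` bits, full strategies ARE perfect, but walk / ring strategies — whose coefficient at the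
cut `g` is `yᵍ·ω^{c+g}` with an `𝔽₂`-valued selector `yᵍ` — are not, except at ONE charge.
Over `WalkCharacterCoefficients.lean` (closed form `u^T·χ_a = ω^{a(T)} Σ_{S⊆T} χ_{σ_S a}`,
selector coefficients are bits, `stratFun`):

* `pdist_aPat_conjAlt`, `lettSum_misSet_aPat_conjAlt`, `pdist_alt_aPat_eq` — closed forms (any
  length `N`, any cut `g`) of `dist(a^{(g)}, ā*)`, of the letter sum `a^{(g)}(Δ_g)` over the
  mismatch set `Δ_g`, and of `dist((1,2,1,2,…), a^{(g)})`, for the near pattern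
  `ā* = (2,1,2,1,…) = conj alt`; on `2D+2` letters: `dist(a^{(g)}, ā*) ≥ D`
  (`le_pdist_aPat_conjAlt`) with equality only at ODD cuts `g ≤ 2D+1`
  (`odd_of_pdist_aPat_conjAlt_le`), where **the phase `g + a^{(g)}(Δ_g) ≡ D+1 (mod 3)` does not
  depend on `g`** (`phase_of_pdist_aPat_conjAlt_le`); the conjugate `(1,2,1,2,…)` is at distance
  `≥ D+1` from the whole path (`succ_le_pdist_alt_aPat'`);
* `Lfun_conjAlt_one` — `L_{ā*}(1) = ω^{3(D+1)} = 1`; **`Lfun_conjAlt_stratFun`** —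
  `L_{ā*}(f) = s · ω^{c+D+1}` for a BIT `s ∈ 𝔽₂` (only odd cuts reach `ā*`, each through the
  single monomial `u^{Δ_g}` with an `𝔽₂`-coefficient, all with the same phase);
* **`ringWinU_exists_fail_phase`** — THE PHASE LAW: if `c + D + 1 ≢ 0 (mod 3)`, every walk
  strategy of `𝔽₂`-degree `≤ D` with charge `c` on `2D+2` bits FAILS on some input (perfect play
  means `tr f ≡ 1`, so `s·ω^{c+D+1} + L_{ā*}(f²) = L_{ā*}(1) = 1` with `L_{ā*}(f²) = 0` by
  Frobenius and farness — impossible for a bit `s`); **`ringWinU_exists_fail_ring`** — in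
  particular at the ring's own charge `c = n + 2` (`c + D + 1 = 3D + 5`).

With the fail floor `ringWinU_fail_floor` (`n ≥ 2D+3`, every charge) this is the lower half of
the RING EXACT LAW `⌊n/2⌋` for ALL `n` (TARGET §15.3); the phase table — `c ≡ −(D+1)` is the
unique easy charge at `n = 2D+2` — was found by brute force for `n ≤ 7` (planner, exp3) and
re-checked by Gaussian elimination for `n ≤ 8`, all charges (prover qn-prover-3 gen 6: law AND
converse hold there).  Ring-side reading — no exact polynomial resolvent of degree `≤ ⌊(N−3)/2⌋`
on ANY `N`-cycle, `N ≥ 5` — in `QuantumAdvantage/Theorems/RingFrameRingToElimPhaseLaw.lean`.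
The cell's theorem (planner qa-qnc0-p1 gen 3, statement and proof sketch; prover qn-prover-3
gen 6, kernel proof), 2026-08-27; not in print.  WHAT THIS IS NOT: an exact-law statement (one
failure per strategy), not a constant-loss bound; the converse (perfect play at the easy charge)
is observed for `n ≤ 8`, not proved; nothing on α at constant `η`; no separation claim.
-/

noncomputable section

namespace Summit.QuantumAdvantage.AdviceFreeQNC0

open Finset
open Literature.Computability.MetaComplexity Literature.Computability.MetaComplexity.Smolensky
open F4

variable {m : ℕ}


/-! ### Combinatorics of the near pattern `ā* = (2,1,2,1,…)` on `2D+2` letters -/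

/-- Count of the mismatches of `a^{(g)}` with `ā*` below `N`. -/
private theorem sum_range_mis_conjAlt (g : ℕ) : ∀ N : ℕ,
    ∑ i ∈ Finset.range N, (if (i % 2 = 1 ∧ i < g) ∨ (i % 2 = 0 ∧ g ≤ i) then 1 else 0) =
      min g N / 2 + ((N + 1) / 2 - (min g N + 1) / 2) := by
  intro N
  induction N with
  | zero => simp
  | succ N ih =>
    rw [Finset.sum_range_succ, ih]
    by_cases h : (N % 2 = 1 ∧ N < g) ∨ (N % 2 = 0 ∧ g ≤ N)
    · rw [if_pos h]; omega
    · rw [if_neg h]; omega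

/-- Letter sum of `a^{(g)}` over its mismatches with `ā*` below `N`. -/
private theorem sum_range_lett_conjAlt (g : ℕ) : ∀ N : ℕ,
    ∑ i ∈ Finset.range N,
      (if (i % 2 = 1 ∧ i < g) ∨ (i % 2 = 0 ∧ g ≤ i) then (if i < g then 2 else 1) else 0) =
      2 * (min g N / 2) + ((N + 1) / 2 - (min g N + 1) / 2) := by
  intro N
  induction N with
  | zero => simp
  | succ N ih =>
    rw [Finset.sum_range_succ, ih]
    by_cases h : (N % 2 = 1 ∧ N < g) ∨ (N % 2 = 0 ∧ g ≤ N)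
    · rw [if_pos h]
      by_cases h' : N < g
      · rw [if_pos h']; omega
      · rw [if_neg h']; omega
    · rw [if_neg h]; omega

/-- Count of the mismatches of `(1,2,1,2,…)` with `a^{(g)}` below `N`. -/
private theorem sum_range_mis_alt (g : ℕ) : ∀ N : ℕ,
    ∑ i ∈ Finset.range N, (if (i % 2 = 0 ∧ i < g) ∨ (i % 2 = 1 ∧ g ≤ i) then 1 else 0) =
      (min g N + 1) / 2 + (N / 2 - min g N / 2) := by
  intro N
  induction N with
  | zero => simp
  | succ N ih =>
    rw [Finset.sum_range_succ, ih]
    by_cases h : (N % 2 = 0 ∧ N < g) ∨ (N % 2 = 1 ∧ g ≤ N)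
    · rw [if_pos h]; omega
    · rw [if_neg h]; omega

/-- Where the path pattern `a^{(g)}` differs from `ā* = conj alt`. -/
theorem aPat_ne_conj_alt_iff (g : ℕ) (i : Fin m) :
    aPat g i ≠ conj alt i ↔ (i.val % 2 = 1 ∧ i.val < g) ∨ (i.val % 2 = 0 ∧ g ≤ i.val) := by
  rw [ne_comm]
  exact conj_alt_ne_aPat_iff g i

/-- The letter of `a^{(g)}` at `i` is `2` before the cut and `1` after. -/
theorem lett_aPat (g : ℕ) (i : Fin m) : lett (aPat g i) = if i.val < g then 2 else 1 := by
  unfold lett aPat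
  by_cases h : i.val < g <;> simp [h]

/-- `dist(a^{(g)}, ā*)` on `N` letters, closed form. -/
theorem pdist_aPat_conjAlt (N g : ℕ) :
    pdist (aPat g) (conj (alt : Fin N → Bool)) = min g N / 2 + ((N + 1) / 2 - (min g N + 1) / 2) := by
  classical
  have e : ∀ i : Fin N, (if aPat g i ≠ conj alt i then 1 else 0) =
      if (i.val % 2 = 1 ∧ i.val < g) ∨ (i.val % 2 = 0 ∧ g ≤ i.val) then 1 else 0 := by
    intro i
    by_cases h : aPat g i ≠ conj alt i
    · rw [if_pos h, if_pos ((aPat_ne_conj_alt_iff g i).1 h)]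
    · rw [if_neg h, if_neg fun h' => h ((aPat_ne_conj_alt_iff g i).2 h')]
  have h2 := Fin.sum_univ_eq_sum_range
    (fun k : ℕ => if (k % 2 = 1 ∧ k < g) ∨ (k % 2 = 0 ∧ g ≤ k) then 1 else 0) N
  beta_reduce at h2
  unfold pdist
  rw [Finset.card_filter, Finset.sum_congr rfl fun i _ => e i, h2, sum_range_mis_conjAlt]

/-- `a^{(g)}(Δ_g)`, the letter sum of the path pattern over its mismatches with `ā*`, closed form. -/
theorem lettSum_misSet_aPat_conjAlt (N g : ℕ) :
    lettSum (misSet (aPat g) (conj (alt : Fin N → Bool))) (aPat g) =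
      2 * (min g N / 2) + ((N + 1) / 2 - (min g N + 1) / 2) := by
  classical
  have e : ∀ i : Fin N, (if aPat g i ≠ conj alt i then lett (aPat g i) else 0) =
      if (i.val % 2 = 1 ∧ i.val < g) ∨ (i.val % 2 = 0 ∧ g ≤ i.val) then (if i.val < g then 2 else 1)
        else 0 := by
    intro i
    by_cases h : aPat g i ≠ conj alt i
    · rw [if_pos h, if_pos ((aPat_ne_conj_alt_iff g i).1 h), lett_aPat]
    · rw [if_neg h, if_neg fun h' => h ((aPat_ne_conj_alt_iff g i).2 h')]
  have h2 := Fin.sum_univ_eq_sum_range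
    (fun k : ℕ => if (k % 2 = 1 ∧ k < g) ∨ (k % 2 = 0 ∧ g ≤ k) then (if k < g then 2 else 1) else 0) N
  beta_reduce at h2
  unfold lettSum misSet
  rw [Finset.sum_filter, Finset.sum_congr rfl fun i _ => e i, h2, sum_range_lett_conjAlt]

/-- `dist((1,2,1,2,…), a^{(g)})` on `N` letters, closed form. -/
theorem pdist_alt_aPat_eq (N g : ℕ) :
    pdist (alt : Fin N → Bool) (aPat g) = (min g N + 1) / 2 + (N / 2 - min g N / 2) := by
  classical
  have e : ∀ i : Fin N, (if alt i ≠ aPat g i then 1 else 0) =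
      if (i.val % 2 = 0 ∧ i.val < g) ∨ (i.val % 2 = 1 ∧ g ≤ i.val) then 1 else 0 := by
    intro i
    by_cases h : alt i ≠ aPat g i
    · rw [if_pos h, if_pos ((alt_ne_aPat_iff g i).1 h)]
    · rw [if_neg h, if_neg fun h' => h ((alt_ne_aPat_iff g i).2 h')]
  have h2 := Fin.sum_univ_eq_sum_range
    (fun k : ℕ => if (k % 2 = 0 ∧ k < g) ∨ (k % 2 = 1 ∧ g ≤ k) then 1 else 0) N
  beta_reduce at h2
  unfold pdist
  rw [Finset.card_filter, Finset.sum_congr rfl fun i _ => e i, h2, sum_range_mis_alt]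

/-- On `2D+2` letters `ā*` is at distance `≥ D` from every path pattern. -/
theorem le_pdist_aPat_conjAlt (D g : ℕ) : D ≤ pdist (aPat g) (conj (alt : Fin (2 * D + 2) → Bool)) := by
  rw [pdist_aPat_conjAlt]; omega

/-- On `2D+2` letters only the ODD cuts `g ≤ 2D+1` are within distance `D` of `ā*`. -/
theorem odd_of_pdist_aPat_conjAlt_le {D g : ℕ}
    (h : pdist (aPat g) (conj (alt : Fin (2 * D + 2) → Bool)) ≤ D) : g % 2 = 1 ∧ g ≤ 2 * D + 1 := by
  rw [pdist_aPat_conjAlt] at h; omega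

/-- **The phase is constant**: for the cuts within distance `D` of `ā*` (on `2D+2` letters),
`g + a^{(g)}(Δ_g) ≡ D + 1 (mod 3)`. -/
theorem phase_of_pdist_aPat_conjAlt_le {D g : ℕ}
    (h : pdist (aPat g) (conj (alt : Fin (2 * D + 2) → Bool)) ≤ D) :
    (g + lettSum (misSet (aPat g) (conj (alt : Fin (2 * D + 2) → Bool))) (aPat g)) % 3 = (D + 1) % 3 := by
  rw [pdist_aPat_conjAlt] at h
  rw [lettSum_misSet_aPat_conjAlt]
  omega

/-- On `2D+2` letters `(1,2,1,2,…)` is at distance `≥ D+1` from every path pattern. -/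
theorem succ_le_pdist_alt_aPat' (D g : ℕ) : D + 1 ≤ pdist (alt : Fin (2 * D + 2) → Bool) (aPat g) := by
  rw [pdist_alt_aPat_eq]; omega

/-! ### The two coefficients at `ā*` -/

/-- Letter sum of `ā*` over all `N` letters, as a range sum. -/
private theorem sum_range_lett_all : ∀ N : ℕ,
    ∑ i ∈ Finset.range N, (if i % 2 = 1 then 1 else 2) = N + (N + 1) / 2 := by
  intro N
  induction N with
  | zero => simp
  | succ N ih =>
    rw [Finset.sum_range_succ, ih]
    by_cases h : N % 2 = 1
    · rw [if_pos h]; omega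
    · rw [if_neg h]; omega

/-- **`L_{ā*}(1) = 1`** on `2D+2` letters (`Πᵢ (1 + ω^{−ā*ᵢ}) = ω^{3(D+1)}`). -/
theorem Lfun_conjAlt_one (D : ℕ) :
    Lfun (conj (alt : Fin (2 * D + 2) → Bool)) (fun _ => (1 : F4)) = 1 := by
  classical
  unfold Lfun
  simp only [one_mul]
  have h := Finset.prod_univ_sum (fun _ : Fin (2 * D + 2) => (univ : Finset Bool))
    (fun i bb => if bb = true then (1 : F4) else ω ^ lett (!(conj (alt : Fin (2 * D + 2) → Bool)) i))
  rw [Fintype.piFinset_univ] at h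
  rw [← h]
  have hfac : ∀ i : Fin (2 * D + 2),
      (∑ bb : Bool, if bb = true then (1 : F4) else ω ^ lett (!(conj (alt : Fin (2 * D + 2) → Bool)) i)) =
        ω ^ (if i.val % 2 = 1 then 1 else 2) := by
    intro i
    rw [Fintype.sum_bool]
    simp only [if_true, Bool.false_eq_true, if_false]
    unfold conj alt lett
    by_cases hi : i.val % 2 = 1
    · simp only [hi, decide_true, Bool.not_not, if_true]
      rw [one_add_omega_sq, pow_one]
    · simp only [hi, decide_false, Bool.not_not, Bool.false_eq_true, if_false]
      rw [pow_one, one_add_omega]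
  have h2 := Fin.sum_univ_eq_sum_range (fun k : ℕ => if k % 2 = 1 then 1 else 2) (2 * D + 2)
  beta_reduce at h2
  rw [Finset.prod_congr rfl fun i _ => hfac i, Finset.prod_pow_eq_pow_sum, h2,
    sum_range_lett_all, omega_pow_mod, show (2 * D + 2 + (2 * D + 2 + 1) / 2) % 3 = 0 by omega, pow_zero]

/-- **`L_{ā*}(f) = s · ω^{c+D+1}` for a bit `s`**: only the odd cuts reach `ā*`, each through the
single monomial `u^{Δ_g}`, all with the same phase. -/
theorem Lfun_conjAlt_stratFun (D c : ℕ) (y : Fin (2 * D + 2 + 1) → (Fin (2 * D + 2) → Bool) → Bool)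
    (hy : ∀ g, HasDeg (y g) D) :
    ∃ s : ZMod 2, Lfun (conj (alt : Fin (2 * D + 2) → Bool)) (stratFun c y) =
      algebraMap (ZMod 2) F4 s * ω ^ ((c + D + 1) % 3) := by
  classical
  set aN : Fin (2 * D + 2) → Bool := conj alt with haN
  have hcut : ∀ g : Fin (2 * D + 2 + 1), ∃ b : ZMod 2,
      Lfun aN (fun u => ιF (y g u) * chi (aPat g.val) u) =
        algebraMap (ZMod 2) F4 b *
          (if pdist (aPat g.val) aN ≤ D then ω ^ lettSum (misSet (aPat g.val) aN) (aPat g.val) else 0) := by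
    intro g
    have e : (fun u => ιF (y g u) * chi (aPat g.val) u) =
        fun u => algebraMap (ZMod 2) F4 ((fun x => if y g x = true then (1 : ZMod 2) else 0) u) *
          chi (aPat g.val) u := by
      funext u
      unfold ιF
      by_cases h : y g u = true <;> simp [h]
    rw [e]
    exact Lfun_lowDeg_mul_chi aN (aPat g.val) (le_pdist_aPat_conjAlt D g.val) (hy g)
  choose b hb using hcut
  refine ⟨∑ g : Fin (2 * D + 2 + 1), if pdist (aPat g.val) aN ≤ D then b g else 0, ?_⟩
  rw [stratFun_eq]
  rw [Lfun_sum_apply aN univ (fun (g : Fin (2 * D + 2 + 1)) u =>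
    ω ^ (c + g.val) * (ιF (y g u) * chi (aPat g.val) u))]
  have hterm : ∀ g : Fin (2 * D + 2 + 1),
      Lfun aN (fun u => ω ^ (c + g.val) * (ιF (y g u) * chi (aPat g.val) u)) =
        algebraMap (ZMod 2) F4 (if pdist (aPat g.val) aN ≤ D then b g else 0) *
          ω ^ ((c + D + 1) % 3) := by
    intro g
    rw [Lfun_mul_apply aN (ω ^ (c + g.val)) (fun u => ιF (y g u) * chi (aPat g.val) u), hb g]
    by_cases hg : pdist (aPat g.val) aN ≤ D
    · rw [if_pos hg, if_pos hg]
      have hph := phase_of_pdist_aPat_conjAlt_le (D := D) (g := g.val) hg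
      rw [← haN] at hph
      calc ω ^ (c + g.val) * (algebraMap (ZMod 2) F4 (b g) *
            ω ^ lettSum (misSet (aPat g.val) aN) (aPat g.val))
          = algebraMap (ZMod 2) F4 (b g) *
              ω ^ (c + g.val + lettSum (misSet (aPat g.val) aN) (aPat g.val)) := by
            rw [pow_add ω (c + g.val)]; ring
        _ = algebraMap (ZMod 2) F4 (b g) * ω ^ ((c + D + 1) % 3) := by
            rw [omega_pow_mod (c + g.val + _),
              show (c + g.val + lettSum (misSet (aPat g.val) aN) (aPat g.val)) % 3 = (c + D + 1) % 3 by
                omega]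
    · rw [if_neg hg, if_neg hg, mul_zero, mul_zero, map_zero, zero_mul]
  rw [Finset.sum_congr rfl fun g _ => hterm g, map_sum, Finset.sum_mul]

/-! ### The phase law -/

/-- The two elements of `𝔽₂`. -/
private theorem zmod2_cases (s : ZMod 2) : s = 0 ∨ s = 1 := by
  fin_cases s
  · exact Or.inl rfl
  · exact Or.inr rfl

/-- **THE RING PHASE LAW.**  On `2D+2` bits, a walk strategy of `𝔽₂`-degree `≤ D` with charge `c`
is NOT perfect unless `c + D + 1 ≡ 0 (mod 3)` (planner qa-qnc0-p1 TARGET §15.3, all `D`, every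
charge). [folklore] -/
theorem ringWinU_exists_fail_phase (D c : ℕ) (hc : (c + D + 1) % 3 ≠ 0)
    (y : Fin (2 * D + 2 + 1) → (Fin (2 * D + 2) → Bool) → Bool) (hy : ∀ g, HasDeg (y g) D) :
    ∃ u, ringWinU c y u = false := by
  classical
  haveI := F4.nontrivial
  by_contra hall'
  have hall : ∀ u, ringWinU c y u = true := fun u => by
    cases h : ringWinU c y u
    · exact absurd ⟨u, h⟩ hall'
    · rfl
  set aN : Fin (2 * D + 2) → Bool := conj alt with haN
  set f := stratFun c y with hf
  -- `tr f ≡ 1`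
  have htr : (fun u => tr (f u)) = fun _ => (1 : F4) := by
    funext u
    rw [hf, tr_stratFun, hall u]
    rfl
  -- `L(tr f) = L(f) + L(f²)`
  have hsplit : Lfun aN (fun u => tr (f u)) = Lfun aN f + Lfun aN (fun u => f u ^ 2) :=
    Lfun_add_apply aN f (fun u => f u ^ 2)
  -- `L(f²) = 0`: `f²` has spectrum near the conjugate path, `ā*`'s conjugate is far
  have hsq : Lfun aN (fun u => f u ^ 2) = 0 := by
    have h1 : f ∈ chiSpan (NearPath (m := 2 * D + 2) D) :=
      fullSpan_le_chiSpan _ _ (stratFun_mem_fullSpan c y hy)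
    have h2 := sq_mem_chiSpan h1
    refine Lfun_eq_zero_of_mem (P := fun b => NearPath (m := 2 * D + 2) D (conj b)) ?_ h2
    rintro ⟨g, hg⟩
    have hcc : conj aN = alt := by funext i; simp [haN, conj]
    rw [hcc] at hg
    have := succ_le_pdist_alt_aPat' D g
    omega
  -- `L(f) = s · ω^{c+D+1}` and `L(1) = 1`
  obtain ⟨s, hs⟩ := Lfun_conjAlt_stratFun D c y hy
  have hone : Lfun aN (fun _ => (1 : F4)) = 1 := Lfun_conjAlt_one D
  have hfin : algebraMap (ZMod 2) F4 s * ω ^ ((c + D + 1) % 3) = 1 := by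
    rw [← hs, ← hone, ← htr, hsplit, hsq, add_zero]
  rcases zmod2_cases s with rfl | rfl
  · rw [map_zero, zero_mul] at hfin
    exact zero_ne_one hfin
  · rw [map_one, one_mul] at hfin
    have h := congrArg tr hfin
    rw [tr_omega_pow, Nat.mod_mod, if_neg hc] at h
    unfold tr at h
    rw [one_pow, add_self] at h
    exact one_ne_zero h

/-- **The ring's own charge is never the easy one**: on `n = 2D+2` bits every walk strategy of
`𝔽₂`-degree `≤ D` with the ring charge `c = n + 2` fails somewhere. [folklore] -/
theorem ringWinU_exists_fail_ring (D : ℕ)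
    (y : Fin (2 * D + 2 + 1) → (Fin (2 * D + 2) → Bool) → Bool) (hy : ∀ g, HasDeg (y g) D) :
    ∃ u, ringWinU (2 * D + 2 + 2) y u = false :=
  ringWinU_exists_fail_phase D (2 * D + 2 + 2) (by omega) y hy

end Summit.QuantumAdvantage.AdviceFreeQNC0

end
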